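import Summits.ValiantsHypothesis.ValiantsHypothesis.Theorems.KPlusLogSqLawStaticPathSweepRealise

/-!
# Route «KPlusLogSqLaw» — parametric max-weight independent set on a path: #CHANGES ALONG A GENERIC SWEEP = #EVENT CROSSINGS

HONEST FRAMING.  Helper toward the crux `WeakLifting` (item `stmt-ValiantsHypothesis-19561`, route `KPlusLogSqLaw`, cell `pub-symmetroid`,
seat val-sym-lift-p4 g8, 2026-08-27) on the line of its witness-plan stub `stub_tridiagonalSectorB` (tropical twin of the STATIC tridiagonal
sector = parametric maximum-weight independent set on a path = Eppstein's parametric closure problem on the fence, arXiv:1504.04073).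
The two sweep inequalities in one statement (`sweep_count_eq`): on a window `(θlo, θhi)` in general position — pairwise distinct crossing
abscissae of the non-parallel prefix-sum pairs, parallel pairs distinct lines, no crossing exactly at the ends — (i) every chain of optimal sets at
strictly increasing parameters inside the window, with pairwise distinct prefix-sum values at each sample and consecutive sets distinct, has at
most `E` steps, and (ii) some such chain has exactly `E` steps, where `E` = the number of EVENT CROSSINGS in the window (pairs `p < q` crossing at
`τ ∈ (θlo, θhi)` with `lab(q-1)(τ) = p` and `q` a right record at `τ`).  So the tropical count of the static path sector on a generic window IS
the dual event count of LINEAR-LAW §2 (val-sym-lift-p4 g7, tools/dual.py), now a kernel identity.  Statements about a path DP; nothing here asserts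
anything about `WeakLifting`, `TropicalB`, `KPlusLogSqLaw`, the stub in its window, `MatrixDescartes` (stmt-ValiantsHypothesis-18050) or `VP ≠ VNP`.
-/

set_option linter.dupNamespace false
set_option autoImplicit false

namespace Summit.ValiantsHypothesis.ValiantsHypothesis.Theorems.KPlusLogSqLaw

open Finset Classical

namespace StaticPathFold

noncomputable section

variable (w₁ w₀ : ℕ → ℝ)

/-- **#CHANGES ALONG A GENERIC SWEEP = #EVENT CROSSINGS.** [folklore] -/
theorem sweep_count_eq {i n : ℕ} {θlo θhi : ℝ} (hlohi : θlo < θhi)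
    (hgen : ∀ p q p' q', p < q → q ≤ n → p' < q' → q' ≤ n → (p ≠ p' ∨ q ≠ q') →
      altA (shift i w₁) p ≠ altA (shift i w₁) q → altA (shift i w₁) p' ≠ altA (shift i w₁) q' →
      (altB (shift i w₀) q - altB (shift i w₀) p) / (altA (shift i w₁) p - altA (shift i w₁) q) ≠
        (altB (shift i w₀) q' - altB (shift i w₀) p') / (altA (shift i w₁) p' - altA (shift i w₁) q'))
    (hpar : ∀ p q, p < q → q ≤ n → altA (shift i w₁) p = altA (shift i w₁) q → altB (shift i w₀) p ≠ altB (shift i w₀) q)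
    (hends : ∀ p q, p < q → q ≤ n → altA (shift i w₁) p ≠ altA (shift i w₁) q →
      (altB (shift i w₀) q - altB (shift i w₀) p) / (altA (shift i w₁) p - altA (shift i w₁) q) ≠ θlo ∧
      (altB (shift i w₀) q - altB (shift i w₀) p) / (altA (shift i w₁) p - altA (shift i w₁) q) ≠ θhi) :
    let E := (((range (n + 1)) ×ˢ (range (n + 1))).filter (fun pq : ℕ × ℕ => pq.1 < pq.2 ∧
        altA (shift i w₁) pq.1 ≠ altA (shift i w₁) pq.2 ∧
        θlo < (altB (shift i w₀) pq.2 - altB (shift i w₀) pq.1) / (altA (shift i w₁) pq.1 - altA (shift i w₁) pq.2) ∧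
        (altB (shift i w₀) pq.2 - altB (shift i w₀) pq.1) / (altA (shift i w₁) pq.1 - altA (shift i w₁) pq.2) < θhi ∧
        lab (altA (shift i w₁)) (altB (shift i w₀)) (pq.2 - 1)
            ((altB (shift i w₀) pq.2 - altB (shift i w₀) pq.1) / (altA (shift i w₁) pq.1 - altA (shift i w₁) pq.2)) = pq.1 ∧
        fold (altA (shift 0 (rev i n w₁))) (altB (shift 0 (rev i n w₀))) (n - pq.2)
            ((altB (shift i w₀) pq.2 - altB (shift i w₀) pq.1) / (altA (shift i w₁) pq.1 - altA (shift i w₁) pq.2)) =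
          L (altA (shift 0 (rev i n w₁))) (altB (shift 0 (rev i n w₀))) (n - pq.2)
            ((altB (shift i w₀) pq.2 - altB (shift i w₀) pq.1) / (altA (shift i w₁) pq.1 - altA (shift i w₁) pq.2)))).card
    (∀ (N : ℕ) (θs : Fin (N + 1) → ℝ) (Ms : Fin (N + 1) → Finset ℕ), StrictMono θs → (∀ k, θlo < θs k ∧ θs k < θhi) →
        (∀ k, Ms k ∈ indepSets i n) → (∀ k, ∑ t ∈ Ms k, W w₁ w₀ t (θs k) = opt w₁ w₀ i n (θs k)) →
        (∀ k, ∀ p q, p ≤ n → q ≤ n → p ≠ q →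
          L (altA (shift i w₁)) (altB (shift i w₀)) p (θs k) ≠ L (altA (shift i w₁)) (altB (shift i w₀)) q (θs k)) →
        (∀ e : Fin N, Ms e.castSucc ≠ Ms e.succ) → N ≤ E) ∧
      (∃ (N : ℕ) (θs : Fin (N + 1) → ℝ) (Ms : Fin (N + 1) → Finset ℕ), N = E ∧ StrictMono θs ∧ (∀ k, θlo < θs k ∧ θs k < θhi) ∧
        (∀ k, Ms k ∈ indepSets i n) ∧ (∀ k, ∑ t ∈ Ms k, W w₁ w₀ t (θs k) = opt w₁ w₀ i n (θs k)) ∧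
        (∀ k, ∀ p q, p ≤ n → q ≤ n → p ≠ q →
          L (altA (shift i w₁)) (altB (shift i w₀)) p (θs k) ≠ L (altA (shift i w₁)) (altB (shift i w₀)) q (θs k)) ∧
        (∀ e : Fin N, Ms e.castSucc ≠ Ms e.succ)) := by
  intro E
  constructor
  · intro N θs Ms hθ hwin hmem hopt hdis hch
    refine (chain_le_card_eventCrossings w₁ w₀ i n N θs hθ Ms hgen hmem hopt hdis hch).trans (card_le_card ?_)
    intro pq hpq
    rw [mem_filter] at hpq ⊢
    obtain ⟨h0, h1, h2, h3, h4, h5, h6⟩ := hpq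
    exact ⟨h0, h1, h2, lt_trans (hwin 0).1 h3, lt_trans h4 (hwin (Fin.last N)).2, h5, h6⟩
  · exact exists_chain_card_eventCrossings w₁ w₀ hlohi hgen hpar hends

end

end StaticPathFold

end Summit.ValiantsHypothesis.ValiantsHypothesis.Theorems.KPlusLogSqLaw
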